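import Summits.RiemannHypothesis.RiemannHypothesis.Theorems.PfPersistenceM2UpperLawCount
import Summits.RiemannHypothesis.RiemannHypothesis.Theorems.SoloInformedGroundStateDecay
import HarnessLib

/-!
# M2 upper half (4/7): the window sum, the small-window fallback, the mollifier's Mellin decay

pub-rhpf cell (M2 seat, generation 3) — part 4 of 7 of the M2 UPPER-HALF packet.  HONEST FRAMING:
long-odds MECHANISM SEARCH; no RH claims.  Everything in this file is PROVED (kernel-checked, RH-free) or an
explicitly named `def … : Prop` taken as an argument; nothing here implies or assumes RH.  The packet's
headline and full ledger are in `PfPersistenceM2UpperLeak.lean` (part 7):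
`ProlateLeakL1 A p Λ` (ONE RH-free prolate leak bound, exponent `p`) + two named literature facts
⇒ `ConnesLawUpperWitnessWith (2p + 1 + δ)` ⇒ `ConnesLawUpperWith (2p + 1 + δ)` ⇒ `ConnesLawUpper`.

This part (PROVED, elementary):
* §H `windowSum_le`: `Σ_{j<M} log(j+2) log²(j+5) min(1, K/(j+1))² ≤ C_ε K^{1+ε}` (`0 < ε ≤ 1`), the
  support of the tree's mollifier `tsupport (moll n) ⊆ [−1/(n+1), 1/(n+1)]`, `0 < ‖moll n‖₂²`, the
  small-window fallback via the tree's `weilGroundEnergy_le_const`: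
  `connesLawUpperWith_of_eventually` (an eventual bound is enough) and
  `connesLawUpperWith_of_witnessWith` (witness form ⇒ energy form).
* §J `mollifierMellinDecay : MollifierMellinDecay` — `‖φ̂_n(s)‖ ‖s − ½‖ ≤ C (n+1) e^{|Re s − ½|/(n+1)}` for the
  tree's mollifier `moll n`, by the scaling `φ_n(x) = (n+1) φ_0((n+1)x)` (`moll_eq_scaled`,
  `weilMellin_moll_scaled`) and ONE integration by parts for a general Weil test function
  (`norm_weilMellin_mul_le_integral_deriv`).  [folklore]
-/

noncomputable section

set_option linter.dupNamespace false  -- the mandated namespace repeats `RiemannHypothesis`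

open Complex Filter Set Topology Metric MeasureTheory
open Literature.NumberTheory.LFunctions
open scoped ComplexConjugate Convolution

namespace Summit.RiemannHypothesis.RiemannHypothesis.Theorems.PfPersistenceM2Leak

/-! ## §H The window sum and the small-window fallback (PROVED, elementary) -/

section WindowSum

/-- `min(1, r)² ≤ r^θ` for `r ≥ 0` and `0 ≤ θ ≤ 2`. -/
theorem min_one_sq_le_rpow {r θ : ℝ} (hr : 0 ≤ r) (hθ : 0 ≤ θ) (hθ2 : θ ≤ 2) :
    (min 1 r) ^ 2 ≤ r ^ θ := by
  rcases le_or_gt 1 r with h1 | h1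
  · rw [min_eq_left h1, one_pow]
    exact Real.one_le_rpow h1 hθ
  · rw [min_eq_right h1.le]
    rcases hr.eq_or_lt with h0 | h0
    · rw [← h0]
      rcases hθ.eq_or_lt with hθ0 | hθ0
      · rw [← hθ0, Real.rpow_zero]; norm_num
      · rw [Real.zero_rpow hθ0.ne']; norm_num
    · calc r ^ 2 = r ^ (2 : ℝ) := (Real.rpow_two r).symm
        _ ≤ r ^ θ := Real.rpow_le_rpow_of_exponent_ge h0 h1.le hθ2

/-- `log(j+2) · log(j+5)² ≤ (6/ε)³ · 5 · (j+1)^{ε/2}` for `0 < ε ≤ 2`. -/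
theorem log_mul_log_sq_le {ε : ℝ} (hε : 0 < ε) (hε2 : ε ≤ 2) (j : ℕ) :
    Real.log ((j : ℝ) + 2) * Real.log ((j : ℝ) + 5) ^ 2 ≤
      (6 / ε) ^ 3 * 5 * ((j : ℝ) + 1) ^ (ε / 2) := by
  have hj : (0 : ℝ) ≤ j := j.cast_nonneg
  have hl2 : 0 ≤ Real.log ((j : ℝ) + 2) := Real.log_nonneg (by linarith)
  have hl5 : 0 ≤ Real.log ((j : ℝ) + 5) := Real.log_nonneg (by linarith)
  have h25 : Real.log ((j : ℝ) + 2) ≤ Real.log ((j : ℝ) + 5) :=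
    Real.log_le_log (by linarith) (by linarith)
  have hlr : Real.log ((j : ℝ) + 5) ≤ ((j : ℝ) + 5) ^ (ε / 6) / (ε / 6) :=
    Real.log_le_rpow_div (by linarith) (by positivity)
  have hpow3 : (((j : ℝ) + 5) ^ (ε / 6)) ^ 3 = ((j : ℝ) + 5) ^ (ε / 2) := by
    rw [← Real.rpow_natCast, ← Real.rpow_mul (by linarith)]; norm_num; ring_nf
  have h51 : ((j : ℝ) + 5) ^ (ε / 2) ≤ 5 * ((j : ℝ) + 1) ^ (ε / 2) := by
    have h5 : (j : ℝ) + 5 ≤ 5 * ((j : ℝ) + 1) := by linarith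
    calc ((j : ℝ) + 5) ^ (ε / 2) ≤ (5 * ((j : ℝ) + 1)) ^ (ε / 2) :=
          Real.rpow_le_rpow (by linarith) h5 (by positivity)
      _ = (5 : ℝ) ^ (ε / 2) * ((j : ℝ) + 1) ^ (ε / 2) :=
          Real.mul_rpow (by norm_num) (by linarith)
      _ ≤ 5 ^ (1 : ℝ) * ((j : ℝ) + 1) ^ (ε / 2) :=
          mul_le_mul_of_nonneg_right
            (Real.rpow_le_rpow_of_exponent_le (by norm_num) (by linarith)) (Real.rpow_nonneg (by linarith) _)
      _ = 5 * ((j : ℝ) + 1) ^ (ε / 2) := by rw [Real.rpow_one]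
  calc Real.log ((j : ℝ) + 2) * Real.log ((j : ℝ) + 5) ^ 2
      ≤ Real.log ((j : ℝ) + 5) * Real.log ((j : ℝ) + 5) ^ 2 :=
        mul_le_mul_of_nonneg_right h25 (sq_nonneg _)
    _ = Real.log ((j : ℝ) + 5) ^ 3 := by ring
    _ ≤ (((j : ℝ) + 5) ^ (ε / 6) / (ε / 6)) ^ 3 := by gcongr
    _ = (6 / ε) ^ 3 * ((j : ℝ) + 5) ^ (ε / 2) := by
        rw [div_pow, hpow3, div_eq_mul_inv, ← inv_pow, inv_div, mul_comm]
    _ ≤ (6 / ε) ^ 3 * (5 * ((j : ℝ) + 1) ^ (ε / 2)) := by gcongr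
    _ = (6 / ε) ^ 3 * 5 * ((j : ℝ) + 1) ^ (ε / 2) := by ring

/-- **Window sum** (PROVED): for `0 < ε ≤ 1` there is `C` with
`Σ_{j<M} log(j+2) · log(j+5)² · min(1, K/(j+1))² ≤ C · K^{1+ε}` for all `K ≥ 1` and all `M`.
(`min(1,r)² ≤ r^{1+ε}` and the logarithms cost `(j+1)^{ε/2}`, leaving the convergent `Σ (j+1)^{−1−ε/2}`.) -/
theorem windowSum_le {ε : ℝ} (hε : 0 < ε) (hε1 : ε ≤ 1) :
    ∃ C : ℝ, 0 < C ∧ ∀ K : ℝ, 1 ≤ K → ∀ M : ℕ,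
      ∑ j ∈ Finset.range M, Real.log ((j : ℝ) + 2) *
          (Real.log ((j : ℝ) + 5) ^ 2 * (min 1 (K / ((j : ℝ) + 1))) ^ 2) ≤ C * K ^ (1 + ε) := by
  -- the convergent series
  set q : ℝ := 1 + ε / 2 with hq
  have hsum : Summable fun j : ℕ ↦ ((j : ℝ) + 1) ^ (-q) := by
    have h := (summable_nat_add_iff 1).2 (Real.summable_nat_rpow.2 (show -q < -1 by rw [hq]; linarith))
    simpa [Nat.cast_add, Nat.cast_one] using h
  set S : ℝ := ∑' j : ℕ, ((j : ℝ) + 1) ^ (-q) with hS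
  have hS0 : 0 ≤ S := tsum_nonneg fun j ↦ Real.rpow_nonneg (by positivity) _
  set C₀ : ℝ := (6 / ε) ^ 3 * 5 with hC₀
  have hC₀0 : 0 < C₀ := by positivity
  refine ⟨C₀ * S + 1, by positivity, fun K hK M ↦ ?_⟩
  have hK0 : 0 < K := by linarith
  have hterm : ∀ j : ℕ, Real.log ((j : ℝ) + 2) *
      (Real.log ((j : ℝ) + 5) ^ 2 * (min 1 (K / ((j : ℝ) + 1))) ^ 2) ≤
      C₀ * K ^ (1 + ε) * ((j : ℝ) + 1) ^ (-q) := by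
    intro j
    have hj1 : (0 : ℝ) < (j : ℝ) + 1 := by positivity
    have hmin : (min 1 (K / ((j : ℝ) + 1))) ^ 2 ≤ (K / ((j : ℝ) + 1)) ^ (1 + ε) :=
      min_one_sq_le_rpow (div_nonneg hK0.le hj1.le) (by linarith) (by linarith)
    have hdiv : (K / ((j : ℝ) + 1)) ^ (1 + ε) = K ^ (1 + ε) * ((j : ℝ) + 1) ^ (-(1 + ε)) := by
      rw [Real.div_rpow hK0.le hj1.le, Real.rpow_neg hj1.le, div_eq_mul_inv]
    have hlog := log_mul_log_sq_le hε (by linarith) j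
    have hl2 : 0 ≤ Real.log ((j : ℝ) + 2) := Real.log_nonneg (by linarith [hj1])
    calc Real.log ((j : ℝ) + 2) * (Real.log ((j : ℝ) + 5) ^ 2 * (min 1 (K / ((j : ℝ) + 1))) ^ 2)
        = (Real.log ((j : ℝ) + 2) * Real.log ((j : ℝ) + 5) ^ 2) * (min 1 (K / ((j : ℝ) + 1))) ^ 2 := by
          ring
      _ ≤ (C₀ * ((j : ℝ) + 1) ^ (ε / 2)) * (K / ((j : ℝ) + 1)) ^ (1 + ε) :=
          mul_le_mul hlog hmin (sq_nonneg _) (by positivity)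
      _ = C₀ * K ^ (1 + ε) * (((j : ℝ) + 1) ^ (ε / 2) * ((j : ℝ) + 1) ^ (-(1 + ε))) := by
          rw [hdiv]; ring
      _ = C₀ * K ^ (1 + ε) * ((j : ℝ) + 1) ^ (-q) := by
          rw [← Real.rpow_add hj1, hq]; ring_nf
  have hKpow : 0 ≤ K ^ (1 + ε) := Real.rpow_nonneg hK0.le _
  calc ∑ j ∈ Finset.range M, Real.log ((j : ℝ) + 2) *
          (Real.log ((j : ℝ) + 5) ^ 2 * (min 1 (K / ((j : ℝ) + 1))) ^ 2)
      ≤ ∑ j ∈ Finset.range M, C₀ * K ^ (1 + ε) * ((j : ℝ) + 1) ^ (-q) := Finset.sum_le_sum fun j _ ↦ hterm j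
    _ = C₀ * K ^ (1 + ε) * ∑ j ∈ Finset.range M, ((j : ℝ) + 1) ^ (-q) := by rw [Finset.mul_sum]
    _ ≤ C₀ * K ^ (1 + ε) * S := by
        refine mul_le_mul_of_nonneg_left ?_ (by positivity)
        exact hsum.sum_le_tsum _ fun j _ ↦ Real.rpow_nonneg (by positivity) _
    _ = C₀ * S * K ^ (1 + ε) := by ring
    _ ≤ (C₀ * S + 1) * K ^ (1 + ε) := by nlinarith

end WindowSum

section Fallback

open WeilContinuous

/-- `tsupport φ_n ⊆ [−1, 1]`. -/
theorem tsupport_moll_subset (n : ℕ) : tsupport (moll n) ⊆ Icc (-1) 1 := by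
  refine closure_minimal (fun t ht ↦ ?_) isClosed_Icc
  rw [mem_Icc, ← abs_le]
  by_contra h
  exact ht (moll_eq_zero ((bump_rOut_le_one n).trans (not_le.1 h).le))

/-- **Eventual ⇒ global**: an upper law valid for `a ≥ a₀` (exponent `B ≥ 0`) holds for all `a ≥ 1`
with a larger constant, because `ε(a)` is bounded above uniformly and `μ^B e^{−4πμ}` is bounded below on
`[1, a₀]`. -/
theorem connesLawUpperWith_of_eventually {B : ℝ} (hB : 0 ≤ B) {a₀ C : ℝ}
    (h : ∀ a : ℝ, a₀ ≤ a → 1 ≤ a →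
      weilGroundEnergy a ≤ C * Real.exp (2 * a) ^ B * Real.exp (-(4 * Real.pi * Real.exp (2 * a)))) :
    ConnesLawUpperWith B := by
  obtain ⟨E₁, -, hE₁⟩ := weilGroundEnergy_le_const
  set a₁ : ℝ := max a₀ 1 with ha₁
  set m₀ : ℝ := Real.exp (-(4 * Real.pi * Real.exp (2 * a₁))) with hm₀
  have hm₀0 : 0 < m₀ := Real.exp_pos _
  refine ⟨max C 0 + max E₁ 0 / m₀, fun a ha ↦ ?_⟩
  have hμ1 : 1 ≤ Real.exp (2 * a) := Real.one_le_exp (by linarith)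
  have hX0 : 0 ≤ Real.exp (2 * a) ^ B * Real.exp (-(4 * Real.pi * Real.exp (2 * a))) :=
    mul_nonneg (Real.rpow_nonneg (Real.exp_pos _).le _) (Real.exp_pos _).le
  rcases le_or_gt a₁ a with h1 | h1
  · have := h a ((le_max_left _ _).trans h1) ha
    calc weilGroundEnergy a ≤ C * Real.exp (2 * a) ^ B * Real.exp (-(4 * Real.pi * Real.exp (2 * a))) := this
      _ = C * (Real.exp (2 * a) ^ B * Real.exp (-(4 * Real.pi * Real.exp (2 * a)))) := by ring
      _ ≤ (max C 0 + max E₁ 0 / m₀) *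
            (Real.exp (2 * a) ^ B * Real.exp (-(4 * Real.pi * Real.exp (2 * a)))) := by
          refine mul_le_mul_of_nonneg_right ?_ hX0
          have : 0 ≤ max E₁ 0 / m₀ := by positivity
          linarith [le_max_left C 0]
      _ = _ := by ring
  · -- `1 ≤ a < a₁`: use the a-priori bound and the lower bound `m₀ ≤ μ^B e^{-4πμ}`
    have hlow : m₀ ≤ Real.exp (2 * a) ^ B * Real.exp (-(4 * Real.pi * Real.exp (2 * a))) := by
      have h2 : m₀ ≤ Real.exp (-(4 * Real.pi * Real.exp (2 * a))) := by
        rw [hm₀]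
        refine Real.exp_le_exp.2 ?_
        have : Real.exp (2 * a) ≤ Real.exp (2 * a₁) := Real.exp_le_exp.2 (by linarith)
        nlinarith [Real.pi_pos]
      calc m₀ = 1 * m₀ := (one_mul _).symm
        _ ≤ Real.exp (2 * a) ^ B * Real.exp (-(4 * Real.pi * Real.exp (2 * a))) :=
            mul_le_mul (Real.one_le_rpow hμ1 hB) h2 hm₀0.le (Real.rpow_nonneg (Real.exp_pos _).le _)
    calc weilGroundEnergy a ≤ E₁ := hE₁ a ha
      _ ≤ max E₁ 0 := le_max_left _ _
      _ = max E₁ 0 / m₀ * m₀ := by field_simp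
      _ ≤ max E₁ 0 / m₀ * (Real.exp (2 * a) ^ B * Real.exp (-(4 * Real.pi * Real.exp (2 * a)))) :=
          mul_le_mul_of_nonneg_left hlow (by positivity)
      _ ≤ (max C 0 + max E₁ 0 / m₀) *
            (Real.exp (2 * a) ^ B * Real.exp (-(4 * Real.pi * Real.exp (2 * a)))) := by
          refine mul_le_mul_of_nonneg_right ?_ hX0
          linarith [le_max_right C 0]
      _ = _ := by ring

/-- The witness form implies the energy form: `ε(a) ≤ Re W(q_a)` for the normalised window test
(`weilGroundEnergy_le_div`), plus the small-window fallback. -/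
theorem connesLawUpperWith_of_witnessWith {B : ℝ} (hB : 0 ≤ B) (h : ConnesLawUpperWitnessWith B) :
    ConnesLawUpperWith B := by
  obtain ⟨C, a₀, q, hq⟩ := h
  refine connesLawUpperWith_of_eventually hB (a₀ := a₀) (C := C) fun a ha _ ↦ ?_
  obtain ⟨⟨hqt, hqs, hq1⟩, hW⟩ := hq a ha
  have hpos : 0 < ∫ t : ℝ, ‖q a t‖ ^ 2 := by rw [hq1]; exact one_pos
  have hle := weilGroundEnergy_le_div hqt hqs hpos
  rw [hq1, div_one] at hle
  exact hle.trans hW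

end Fallback

/-! ## §J The mollifier decay (proved): scaling + one integration by parts -/

section MollDecay

open WeilContinuous

/-- **Mellin decay of the tree's mollifier (folklore, RH-free; PROVED below, `mollifierMellinDecay`).**
`‖φ̂_n(s)‖ · ‖s − ½‖ ≤ C (n+1) e^{|Re s − ½|/(n+1)}`: one integration by parts for `φ_0` and the scaling
`φ_n(x) = (n+1) φ_0((n+1)x)`, `φ̂_n(s) = φ̂_0(½ + (s−½)/(n+1))`. -/
def MollifierMellinDecay : Prop :=
  ∃ C : ℝ, 0 < C ∧ ∀ (n : ℕ) (s : ℂ),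
    ‖weilMellin (moll n) s‖ * ‖s - 1 / 2‖ ≤ C * ((n : ℝ) + 1) * Real.exp (|s.re - 1 / 2| / ((n : ℝ) + 1))

/-- `rIn = 1/(2(k+1))`. -/
lemma bump_rIn (k : ℕ) : (bump k).rIn = 1 / (2 * ((k : ℝ) + 1)) := rfl

/-- Scaling of the bumps: `bump n x = bump 0 ((n+1) x)`. -/
lemma bump_apply_eq (n : ℕ) (x : ℝ) : (bump n) x = (bump 0) (((n : ℝ) + 1) * x) := by
  have hr : (bump n).rOut / (bump n).rIn = 2 := by
    rw [bump_rOut, bump_rIn]; field_simp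
  have hr0 : (bump 0).rOut / (bump 0).rIn = 2 := by
    rw [bump_rOut, bump_rIn]; norm_num
  have ha : (bump n).rIn⁻¹ • (x - 0) = (bump 0).rIn⁻¹ • (((n : ℝ) + 1) * x - 0) := by
    rw [bump_rIn, bump_rIn, smul_eq_mul, smul_eq_mul, sub_zero, sub_zero, one_div, one_div, inv_inv,
      inv_inv]; push_cast; ring
  rw [ContDiffBump.apply, ContDiffBump.apply, hr, hr0, ha]

/-- `∫ bump n = (∫ bump 0)/(n+1)` (scaling). -/
lemma integral_bump_eq (n : ℕ) :
    ∫ x, (bump n) x = (∫ x, (bump 0) x) / ((n : ℝ) + 1) := by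
  have h : (fun x ↦ (bump n) x) = fun x ↦ (bump 0) (((n : ℝ) + 1) * x) := funext (bump_apply_eq n)
  have hn : (0 : ℝ) < (n : ℝ) + 1 := by positivity
  rw [h, Measure.integral_comp_mul_left (fun y ↦ (bump 0) y), smul_eq_mul, abs_of_pos (inv_pos.2 hn),
    div_eq_inv_mul]

/-- Scaling of the mollifiers: `φ_n(x) = (n+1) φ_0((n+1) x)`. -/
lemma moll_eq_scaled (n : ℕ) (x : ℝ) :
    moll n x = (((n : ℝ) + 1 : ℝ) : ℂ) * moll 0 (((n : ℝ) + 1) * x) := by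
  have hn : ((n : ℝ) + 1) ≠ 0 := by positivity
  have hI : (∫ x, (bump 0) x) ≠ 0 := ((bump 0).integral_pos (μ := volume)).ne'
  rw [moll, moll, ContDiffBump.normed_def, ContDiffBump.normed_def, bump_apply_eq n x,
    integral_bump_eq n]
  push_cast
  field_simp

/-- Scaling on the Mellin side: `φ̂_n(s) = φ̂_0(½ + (s − ½)/(n+1))`. -/
lemma weilMellin_moll_scaled (n : ℕ) (s : ℂ) :
    weilMellin (moll n) s = weilMellin (moll 0) (1 / 2 + (s - 1 / 2) * ((((n : ℝ) + 1)⁻¹ : ℝ) : ℂ)) := by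
  have hn : (0 : ℝ) < (n : ℝ) + 1 := by positivity
  have hnc : ((n : ℂ) + 1) ≠ 0 := Nat.cast_add_one_ne_zero n
  unfold weilMellin
  obtain ⟨G, hG⟩ : ∃ G : ℝ → ℂ, G = fun v ↦ (((n : ℝ) + 1 : ℝ) : ℂ) *
    (moll 0 v * cexp ((1 / 2 + (s - 1 / 2) * ((((n : ℝ) + 1)⁻¹ : ℝ) : ℂ) - 1 / 2) * v)) := ⟨_, rfl⟩
  have hexp : ∀ t : ℝ, (1 / 2 + (s - 1 / 2) * ((((n : ℝ) + 1)⁻¹ : ℝ) : ℂ) - 1 / 2) *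
      ((((n : ℝ) + 1) * t : ℝ) : ℂ) = (s - 1 / 2) * (t : ℂ) := by
    intro t; push_cast; field_simp; ring
  have h : (fun t : ℝ ↦ moll n t * cexp ((s - 1 / 2) * t)) = fun t ↦ G (((n : ℝ) + 1) * t) := by
    funext t
    rw [hG, moll_eq_scaled n t]
    dsimp only
    rw [hexp]; ring
  rw [h, Measure.integral_comp_mul_left G, abs_of_pos (inv_pos.2 hn), hG]
  dsimp only
  rw [integral_const_mul, Complex.real_smul, ← mul_assoc]
  push_cast
  rw [inv_mul_cancel₀ hnc, one_mul]

/-- Integration by parts for a test function: `‖ĝ(s)‖ · ‖s − ½‖ ≤ e^{|Re s − ½| R} ∫ ‖g'‖`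
when `tsupport g ⊆ [−R, R]`. -/
theorem norm_weilMellin_mul_le_integral_deriv {g : ℝ → ℂ} (hg : IsWeilTest g) {R : ℝ}
    (hR : tsupport g ⊆ Icc (-R) R) (s : ℂ) :
    ‖weilMellin g s‖ * ‖s - 1 / 2‖ ≤ Real.exp (|s.re - 1 / 2| * R) * ∫ t : ℝ, ‖deriv g t‖ := by
  have hI0 : 0 ≤ ∫ t : ℝ, ‖deriv g t‖ := integral_nonneg fun _ ↦ norm_nonneg _
  by_cases hw : s - 1 / 2 = 0
  · rw [hw, norm_zero, mul_zero]; positivity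
  have hdiff : Differentiable ℝ g := hg.1.differentiable (by simp)
  have hgc : Continuous g := hg.1.continuous
  have hg'c : Continuous (deriv g) := hg.1.continuous_deriv (by simp)
  have hg's : HasCompactSupport (deriv g) := hg.2.deriv
  -- `v t = e^{wt}/w`, `v' t = e^{wt}`
  have hv : ∀ t : ℝ, HasDerivAt (fun t : ℝ ↦ cexp ((s - 1 / 2) * t) / (s - 1 / 2))
      (cexp ((s - 1 / 2) * t)) t := by
    intro t
    have h1 : HasDerivAt (fun t : ℝ ↦ (s - 1 / 2) * (t : ℂ)) ((s - 1 / 2) * 1) t :=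
      (hasDerivAt_id t).ofReal_comp.const_mul _
    have h2 := (h1.cexp).div_const (s - 1 / 2)
    refine h2.congr_deriv ?_
    rw [mul_one, mul_div_assoc, div_self hw, mul_one]
  have hec : Continuous fun t : ℝ ↦ cexp ((s - 1 / 2) * t) := by fun_prop
  have hvc : Continuous fun t : ℝ ↦ cexp ((s - 1 / 2) * t) / (s - 1 / 2) := hec.div_const _
  have huv' : Integrable ((g) * fun t : ℝ ↦ cexp ((s - 1 / 2) * t)) :=
    (hgc.mul hec).integrable_of_hasCompactSupport hg.2.mul_right
  have hu'v : Integrable ((deriv g) * fun t : ℝ ↦ cexp ((s - 1 / 2) * t) / (s - 1 / 2)) :=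
    (hg'c.mul hvc).integrable_of_hasCompactSupport hg's.mul_right
  have huv : Integrable ((g) * fun t : ℝ ↦ cexp ((s - 1 / 2) * t) / (s - 1 / 2)) :=
    (hgc.mul hvc).integrable_of_hasCompactSupport hg.2.mul_right
  have hibp := integral_mul_deriv_eq_deriv_mul_of_integrable
    (u := g) (u' := deriv g) (v := fun t : ℝ ↦ cexp ((s - 1 / 2) * t) / (s - 1 / 2))
    (v' := fun t : ℝ ↦ cexp ((s - 1 / 2) * t))
    (fun t _ ↦ (hdiff t).hasDerivAt) (fun t _ ↦ hv t) huv' hu'v huv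
  have hM : weilMellin g s = -∫ t : ℝ, deriv g t * (cexp ((s - 1 / 2) * t) / (s - 1 / 2)) := by
    unfold weilMellin; rw [hibp]
  -- pointwise bound of the new integrand
  have hpt : ∀ t : ℝ, ‖deriv g t * (cexp ((s - 1 / 2) * t) / (s - 1 / 2))‖ ≤
      ‖deriv g t‖ * (Real.exp (|s.re - 1 / 2| * R) / ‖s - 1 / 2‖) := by
    intro t
    rw [norm_mul, norm_div]
    by_cases ht : t ∈ Icc (-R) R
    · refine mul_le_mul_of_nonneg_left (div_le_div_of_nonneg_right ?_ (norm_nonneg _)) (norm_nonneg _)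
      rw [Complex.norm_exp]
      refine Real.exp_le_exp.2 ?_
      have hre : ((s - 1 / 2) * (t : ℂ)).re = (s.re - 1 / 2) * t := by
        simp [Complex.mul_re]
      rw [hre]
      have h1 : |t| ≤ R := abs_le.2 ⟨by linarith [ht.1], ht.2⟩
      calc (s.re - 1 / 2) * t ≤ |(s.re - 1 / 2) * t| := le_abs_self _
        _ = |s.re - 1 / 2| * |t| := abs_mul _ _
        _ ≤ |s.re - 1 / 2| * R := mul_le_mul_of_nonneg_left h1 (abs_nonneg _)
    · have h0 : deriv g t = 0 := by
        have : t ∉ Function.support (deriv g) := fun h ↦ ht (hR (support_deriv_subset h))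
        simpa [Function.mem_support] using this
      rw [h0, norm_zero, zero_mul, zero_mul]
  have hint : Integrable fun t : ℝ ↦ ‖deriv g t‖ * (Real.exp (|s.re - 1 / 2| * R) / ‖s - 1 / 2‖) :=
    (hg'c.norm.integrable_of_hasCompactSupport hg's.norm).mul_const _
  have hn := norm_integral_le_of_norm_le hint (Eventually.of_forall hpt)
  rw [integral_mul_const] at hn
  have hw0 : 0 < ‖s - 1 / 2‖ := norm_pos_iff.2 hw
  rw [hM, norm_neg, ← le_div_iff₀ hw0]
  calc ‖∫ t : ℝ, deriv g t * (cexp ((s - 1 / 2) * t) / (s - 1 / 2))‖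
      ≤ (∫ t : ℝ, ‖deriv g t‖) * (Real.exp (|s.re - 1 / 2| * R) / ‖s - 1 / 2‖) := hn
    _ = Real.exp (|s.re - 1 / 2| * R) * (∫ t : ℝ, ‖deriv g t‖) / ‖s - 1 / 2‖ := by ring

/-- **PROVED: the mollifier decay.** -/
theorem mollifierMellinDecay : MollifierMellinDecay := by
  have hR : tsupport (moll 0) ⊆ Icc (-1) 1 := tsupport_moll_subset 0
  have hI0 : 0 ≤ ∫ t : ℝ, ‖deriv (moll 0) t‖ := integral_nonneg fun _ ↦ norm_nonneg _
  refine ⟨(∫ t : ℝ, ‖deriv (moll 0) t‖) + 1, by linarith, fun n s ↦ ?_⟩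
  have hn : (0 : ℝ) < (n : ℝ) + 1 := by positivity
  obtain ⟨s', hs'⟩ : ∃ s' : ℂ, s' = 1 / 2 + (s - 1 / 2) * ((((n : ℝ) + 1)⁻¹ : ℝ) : ℂ) := ⟨_, rfl⟩
  have h1 := norm_weilMellin_mul_le_integral_deriv (isWeilTest_moll 0) hR s'
  rw [weilMellin_moll_scaled n s, ← hs']
  have hd : s' - 1 / 2 = (s - 1 / 2) * ((((n : ℝ) + 1)⁻¹ : ℝ) : ℂ) := by rw [hs']; ring
  have hre : s'.re - 1 / 2 = (s.re - 1 / 2) * ((n : ℝ) + 1)⁻¹ := by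
    have := congrArg Complex.re hd
    rw [Complex.re_mul_ofReal, Complex.sub_re, Complex.sub_re] at this
    norm_num at this
    linarith
  have hnorm : ‖s - 1 / 2‖ = ((n : ℝ) + 1) * ‖s' - 1 / 2‖ := by
    rw [hd, norm_mul, Complex.norm_real, Real.norm_eq_abs, abs_of_pos (inv_pos.2 hn)]
    field_simp
  have hE := Real.exp_pos (|s.re - 1 / 2| / ((n : ℝ) + 1))
  calc ‖weilMellin (moll 0) s'‖ * ‖s - 1 / 2‖
      = ((n : ℝ) + 1) * (‖weilMellin (moll 0) s'‖ * ‖s' - 1 / 2‖) := by rw [hnorm]; ring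
    _ ≤ ((n : ℝ) + 1) * (Real.exp (|s'.re - 1 / 2| * 1) * ∫ t : ℝ, ‖deriv (moll 0) t‖) :=
        mul_le_mul_of_nonneg_left h1 hn.le
    _ = ((n : ℝ) + 1) * Real.exp (|s.re - 1 / 2| / ((n : ℝ) + 1)) * ∫ t : ℝ, ‖deriv (moll 0) t‖ := by
        rw [hre, mul_one, abs_mul, abs_of_pos (inv_pos.2 hn), ← div_eq_mul_inv]; ring
    _ ≤ ((∫ t : ℝ, ‖deriv (moll 0) t‖) + 1) * ((n : ℝ) + 1) *
          Real.exp (|s.re - 1 / 2| / ((n : ℝ) + 1)) := by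
        have := mul_pos hn hE
        nlinarith

end MollDecay

end Summit.RiemannHypothesis.RiemannHypothesis.Theorems.PfPersistenceM2Leak
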